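import Literature.NumberTheory.Rogawski1990.CartanInvariant
import Literature.LinearAlgebra.Matrix.CentraliserOfSeparableCharpoly
import HarnessLib

/-!
# The Cartan algebra `Z(γ) = L[γ]` of a regular element of `U(H)`, its involution `⋆ : y ↦ H⁻¹ ᵗ(σy) H`, and the norm reading of the invariant
# (Rogawski 1990, §3.5–3.6: for `γ` regular, `G_γ = T`, `L′ = L[γ] = K ⊗ E`, `T = {x ∈ L′ : x x⋆ = 1}`, `H¹(F, T) ≅ L^×∕N_{L′∕L} L′^×`)

Topic `NumberTheory/Rogawski1990`; namespace `Literature.NumberTheory.Rogawski1990`.  TWO definitions with bodies (`hermStar`, the `H`-adjoint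
involution on matrices; `cartanAlgebra γ := Subalgebra.centralizer R {γ}`, the carrier `Z(γ)` — for `γ` regular semisimple this IS `L[γ] = K ⊗_F E`,
★ `LinearAlgebra/EndomorphismBicommutant`, ★ `Matrix/CentraliserOfSeparableCharpoly`) + proved theorems; no instance, no notation, no named fact,
no `sorry`.  Cell `pub/hodgecm-mathlib`, ENGINE T1 (stmt-HodgeConjecture-24833), F0P3a GO #96 (2) row G6∕R2 (sequel of ★-to-be R1 `CartanInvariant`):
the CARRIER that R3 (A-p14: `K = B^τ ≃ ∏ Kᵢ`, Hasse), R4∕F3′ (A-p10: adelic injectivity), R5 (A-p04: local index) and R6∕R7 (`obs`, `ObsHasse`)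
consume — `B := ↥(cartanAlgebra γ)` with `τ := hermStar σ H` — over ANY commutative ring `R` with endomorphism `σ` and `H` with `IsUnit H.det`
(so that it is read verbatim at `R = L`, `L ⊗ L⁺_v`, `𝔸_L`, `L ⊗ ℝ`), plus the field-level commutativity of `Z(γ)` for `γ` regular.

* §1 `hermStar σ H y := H⁻¹ ᵗ(σy) H` — anti-multiplicative (`hermStar_mul`), unital, involutive for `σ` an involution and `H` σ-hermitian
  (`hermStar_hermStar`), additive, `σ`-semilinear (`hermStar_smul`); **`hermStar_mul_self_of_mem_unitaryGroup`** (`u⋆ u = 1`, so `u⋆ = u⁻¹` on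
  `U(H)(R)`); **`inv_mul_twistGram_eq`**: R1's invariant reads `H⁻¹ H_g = g⋆ g`; `inv_mul_twistGram_mul`: `H⁻¹ H_{gt} = t⋆ (g⋆ g) t`.
* §2 `cartanAlgebra γ` = the centraliser subalgebra: `mem_cartanAlgebra_iff` (`↔ Commute x γ`), `self_mem`, `inv_mem` (for `γ ∈ GL`),
  **`hermStar_mem_cartanAlgebra`** (`Z(γ)` is `⋆`-stable when `γ ∈ U(H)(R)`: `⋆γ = γ⁻¹`), **`inv_mul_twistGram_mem_cartanAlgebra`** (R1's `x = H⁻¹ H_g ∈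
  Z(γ)`), `hermStar_inv_mul_twistGram` (`x⋆ = x` for `σ` involutive, `H` hermitian); and the CRITERION of R1 in `⋆`-language:
  **`exists_unitary_conj_iff_exists_hermStar_mul_mul_eq_one`** — `δ ∼_{U(H)(R)} γ ↔ ∃ t ∈ GL_n(R) ∩ Z(γ), t⋆ · x · t = 1`.
* §3 (field `K`, `γ` with SEPARABLE characteristic polynomial = regular semisimple) `mul_comm_of_mem_cartanAlgebra` (★ `commute_of_commute_of_charpoly_separable`:
  `Z(γ)` is COMMUTATIVE), hence the NORM form of the criterion **`exists_unitary_conj_iff_exists_norm_eq`**: `δ ∼ γ ↔ ∃ t ∈ Z(γ)ˣ, x · (t⋆ t) = 1`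
  — i.e. `inv(γ, δ) = [x] ∈ (Z(γ)^{⋆=1})ˣ ∕ {t⋆ t}` is trivial; this quotient is `Kˣ ∕ N_{KE∕K}((KE)ˣ) = H¹(F, T_γ)` of [Rogawski1990, Prop. 3.5.2 (a)]
  (the identification `Z(γ) = K ⊗ E`, `K = Z(γ)^{⋆}`, is R3's packaging over `(B, τ) := (cartanAlgebra γ, hermStar)`).
HC_CM is proved only modulo the printed citations until rung 0 closes; this file is unconditional matrix algebra.

## References
* [Rogawski1990] J. D. Rogawski, *Automorphic Representations of Unitary Groups in Three Variables*, Ann. of Math. Stud. 123 (1990), §3.1 p. 19,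
  §3.5 Prop. 3.5.2 pp. 29–30, §3.6 p. 31.
* [Kottwitz1986] R. E. Kottwitz, *Stable trace formula: elliptic singular terms*, Math. Ann. 275 (1986), §7.
-/

set_option autoImplicit false

noncomputable section

namespace Literature.NumberTheory.Rogawski1990

open scoped MatrixGroups Matrix
open Literature.AlgebraicGeometry.ShimuraVarieties (unitaryGroup mem_unitaryGroup_iff)

section Star

variable {R : Type*} [CommRing R] {n : Type*} [Fintype n] [DecidableEq n] (σ : R →+* R) (H : Matrix n n R)

/-! ## §1 The `H`-adjoint `y⋆ = H⁻¹ ᵗ(σy) H` -/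

/-- **`y⋆ := H⁻¹ ᵗ(σy) H`** — the adjoint for the form `H` (so that `U(H)(R) = {u : u⋆ u = 1}` when `H` is invertible; on the Cartan algebra of a
regular `γ` it is the involution `τ` with `T_γ = {x : x x⋆ = 1}`). [cite: Rogawski1990, §3.5 p. 29] -/
def hermStar (y : Matrix n n R) : Matrix n n R :=
  H⁻¹ * (y.map σ)ᵀ * H

/-- Unfolding of `hermStar`. [cite: Rogawski1990, §3.5 p. 29] -/
theorem hermStar_def (y : Matrix n n R) : hermStar σ H y = H⁻¹ * (y.map σ)ᵀ * H := rfl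

/-- `⋆` is additive. [cite: Rogawski1990, §3.5 p. 29] -/
theorem hermStar_add (x y : Matrix n n R) : hermStar σ H (x + y) = hermStar σ H x + hermStar σ H y := by
  have h : (x + y).map σ = x.map σ + y.map σ := by
    ext i j
    simp only [Matrix.map_apply, Matrix.add_apply, map_add]
  rw [hermStar_def, hermStar_def, hermStar_def, h, Matrix.transpose_add, Matrix.mul_add, Matrix.add_mul]

/-- `⋆` is `σ`-semilinear: `(c • y)⋆ = σ c • y⋆`. [cite: Rogawski1990, §3.5 p. 29] -/
theorem hermStar_smul (c : R) (y : Matrix n n R) : hermStar σ H (c • y) = σ c • hermStar σ H y := by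
  have h : (c • y).map σ = σ c • y.map σ := by
    ext i j
    simp only [Matrix.map_apply, Matrix.smul_apply, smul_eq_mul, map_mul]
  simp only [hermStar_def, h, Matrix.transpose_smul, Matrix.mul_smul, Matrix.smul_mul]

/-- **`⋆` is anti-multiplicative**: `(x y)⋆ = y⋆ x⋆` (for `H` invertible). [cite: Rogawski1990, §3.5 p. 29] -/
theorem hermStar_mul (hH : IsUnit H.det) (x y : Matrix n n R) : hermStar σ H (x * y) = hermStar σ H y * hermStar σ H x := by
  simp only [hermStar_def, Matrix.map_mul, Matrix.transpose_mul, Matrix.mul_assoc]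
  rw [← Matrix.mul_assoc H H⁻¹, Matrix.mul_nonsing_inv H hH, Matrix.one_mul]

/-- `1⋆ = 1` (for `H` invertible). [cite: Rogawski1990, §3.5 p. 29] -/
theorem hermStar_one (hH : IsUnit H.det) : hermStar σ H 1 = 1 := by
  rw [hermStar_def, Matrix.map_one σ (map_zero σ) (map_one σ), Matrix.transpose_one, Matrix.mul_one, Matrix.nonsing_inv_mul H hH]

/-- **`⋆` is an involution** when `σ` is an involution and `H` is σ-hermitian (`ᵗ(σH) = H`) and invertible. [cite: Rogawski1990, §3.5 p. 29] -/
theorem hermStar_hermStar (hH : IsUnit H.det) (hσ : ∀ r : R, σ (σ r) = r) (hHh : (H.map σ)ᵀ = H) (y : Matrix n n R) :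
    hermStar σ H (hermStar σ H y) = y := by
  have hyy : ((y.map σ)ᵀ.map σ)ᵀ = y := by
    rw [Matrix.transpose_map, Matrix.transpose_transpose]
    ext i j
    simp only [Matrix.map_apply, hσ]
  -- `ᵗσ(H⁻¹) = H⁻¹` from `ᵗσH = H`
  have hHinvh : ((H⁻¹).map σ)ᵀ = H⁻¹ := by
    have h1 : ((H⁻¹).map σ)ᵀ * H = 1 := by
      calc ((H⁻¹).map σ)ᵀ * H = ((H⁻¹).map σ)ᵀ * (H.map σ)ᵀ := by rw [hHh]
        _ = ((H * H⁻¹).map σ)ᵀ := by rw [Matrix.map_mul, Matrix.transpose_mul]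
        _ = 1 := by rw [Matrix.mul_nonsing_inv H hH, Matrix.map_one σ (map_zero σ) (map_one σ), Matrix.transpose_one]
    exact (Matrix.inv_eq_left_inv h1).symm
  rw [hermStar_def, hermStar_def, Matrix.map_mul, Matrix.map_mul, Matrix.transpose_mul, Matrix.transpose_mul, hyy, hHh, hHinvh]
  simp only [Matrix.mul_assoc]
  rw [Matrix.nonsing_inv_mul H hH, Matrix.mul_one, ← Matrix.mul_assoc, Matrix.nonsing_inv_mul H hH, Matrix.one_mul]

/-- **`u⋆ u = 1` for `u ∈ U(H)(R)`** (for `H` invertible): multiply `ᵗ(σu) H u = H` by `H⁻¹`. [cite: Rogawski1990, §3.1 p. 19] -/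
theorem hermStar_mul_self_of_mem_unitaryGroup (hH : IsUnit H.det) {u : GL n R} (hu : u ∈ unitaryGroup σ H) :
    hermStar σ H (u : Matrix n n R) * (u : Matrix n n R) = 1 := by
  rw [hermStar_def, Matrix.mul_assoc, Matrix.mul_assoc, ← Matrix.mul_assoc ((u : Matrix n n R).map σ)ᵀ, mem_unitaryGroup_iff.mp hu,
    Matrix.nonsing_inv_mul H hH]

/-- `u⋆ = u⁻¹` on `U(H)(R)` (for `H` invertible). [cite: Rogawski1990, §3.1 p. 19] -/
theorem hermStar_coe_eq_inv_of_mem_unitaryGroup (hH : IsUnit H.det) {u : GL n R} (hu : u ∈ unitaryGroup σ H) :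
    hermStar σ H (u : Matrix n n R) = ((u⁻¹ : GL n R) : Matrix n n R) := by
  have h := hermStar_mul_self_of_mem_unitaryGroup σ H hH hu
  calc hermStar σ H (u : Matrix n n R) = hermStar σ H (u : Matrix n n R) * ((u : Matrix n n R) * ((u⁻¹ : GL n R) : Matrix n n R)) := by
        rw [← Units.val_mul, mul_inv_cancel, Units.val_one, Matrix.mul_one]
    _ = ((u⁻¹ : GL n R) : Matrix n n R) := by rw [← Matrix.mul_assoc, h, Matrix.one_mul]

/-- **R1's invariant in `⋆`-language**: `H⁻¹ H_g = g⋆ g`. [cite: Rogawski1990, §3.1 p. 19] -/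
theorem inv_mul_twistGram_eq (g : Matrix n n R) : H⁻¹ * twistGram σ H g = hermStar σ H g * g := by
  simp only [twistGram_def, hermStar_def, Matrix.mul_assoc]

/-- `H⁻¹ H_{g t} = t⋆ (g⋆ g) t` (for `H` invertible). [cite: Rogawski1990, §3.1 p. 19] -/
theorem inv_mul_twistGram_mul (hH : IsUnit H.det) (g t : Matrix n n R) :
    H⁻¹ * twistGram σ H (g * t) = hermStar σ H t * (H⁻¹ * twistGram σ H g) * t := by
  rw [inv_mul_twistGram_eq, inv_mul_twistGram_eq, hermStar_mul σ H hH]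
  simp only [Matrix.mul_assoc]

/-! ## §2 The Cartan algebra `Z(γ)` and the criterion in `⋆`-language -/

/-- **`cartanAlgebra γ := Z(γ)`**, the centraliser of `γ` in `M_n(R)` as an `R`-subalgebra — for `γ` regular semisimple over a field this is the
commutative étale algebra `L[γ] = K ⊗_F E` of [Rogawski1990, §3.5] (`K` = its `⋆`-fixed part), whose norm-one torus is `G_γ = T`.
[cite: Rogawski1990, §3.5 p. 29] -/
def cartanAlgebra (γ : Matrix n n R) : Subalgebra R (Matrix n n R) :=
  Subalgebra.centralizer R {γ}

/-- `x ∈ Z(γ) ↔ x` commutes with `γ`. [cite: Rogawski1990, §3.5 p. 29] -/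
theorem mem_cartanAlgebra_iff {γ x : Matrix n n R} : x ∈ cartanAlgebra γ ↔ Commute x γ := by
  rw [cartanAlgebra, Subalgebra.mem_centralizer_iff]
  simp only [Set.mem_singleton_iff, forall_eq]
  exact ⟨fun h => h.symm, fun h => h.symm⟩

/-- `γ ∈ Z(γ)`. [cite: Rogawski1990, §3.5 p. 29] -/
theorem self_mem_cartanAlgebra (γ : Matrix n n R) : γ ∈ cartanAlgebra γ :=
  mem_cartanAlgebra_iff.mpr (Commute.refl γ)

/-- `γ⁻¹ ∈ Z(γ)` for `γ ∈ GL_n(R)`. [cite: Rogawski1990, §3.5 p. 29] -/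
theorem coe_inv_mem_cartanAlgebra (γ : GL n R) : ((γ⁻¹ : GL n R) : Matrix n n R) ∈ cartanAlgebra (γ : Matrix n n R) := by
  rw [mem_cartanAlgebra_iff]
  show ((γ⁻¹ : GL n R) : Matrix n n R) * (γ : Matrix n n R) = (γ : Matrix n n R) * ((γ⁻¹ : GL n R) : Matrix n n R)
  rw [← Units.val_mul, ← Units.val_mul, inv_mul_cancel, mul_inv_cancel]

/-- **`Z(γ)` is `⋆`-stable for `γ ∈ U(H)(R)`**: `x γ = γ x ⇒ x⋆ γ = γ x⋆` (apply `⋆`: `γ⋆ x⋆ = x⋆ γ⋆` with `γ⋆ = γ⁻¹`).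
[cite: Rogawski1990, §3.5 p. 29] -/
theorem hermStar_mem_cartanAlgebra (hH : IsUnit H.det) {γ : GL n R} (hγ : γ ∈ unitaryGroup σ H) {x : Matrix n n R}
    (hx : x ∈ cartanAlgebra (γ : Matrix n n R)) : hermStar σ H x ∈ cartanAlgebra (γ : Matrix n n R) := by
  rw [mem_cartanAlgebra_iff] at hx ⊢
  -- `x⋆` commutes with `γ⁻¹ = γ⋆`
  have h1 : Commute (hermStar σ H x) ((γ⁻¹ : GL n R) : Matrix n n R) := by
    rw [← hermStar_coe_eq_inv_of_mem_unitaryGroup σ H hH hγ]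
    show hermStar σ H x * hermStar σ H γ = hermStar σ H γ * hermStar σ H x
    rw [← hermStar_mul σ H hH, ← hermStar_mul σ H hH, hx.eq]
  -- hence with `γ = (γ⁻¹)⁻¹`
  have h2 : Commute (hermStar σ H x) (((γ⁻¹)⁻¹ : GL n R) : Matrix n n R) := h1.units_inv_right
  rwa [inv_inv] at h2

/-- **R1's invariant lies in the Cartan algebra**: `x := H⁻¹ H_g ∈ Z(γ)` for a stable conjugator `g` of `γ, δ ∈ U(H)(R)` (★ R1
`commute_inv_mul_twistGram`). [cite: Rogawski1990, §3.1 p. 19; §3.5 p. 29] -/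
theorem inv_mul_twistGram_mem_cartanAlgebra (hH : IsUnit H.det) {γ δ : unitaryGroup σ H} {g : GL n R} (hg : g * (γ : GL n R) * g⁻¹ = δ) :
    H⁻¹ * twistGram σ H (g : Matrix n n R) ∈ cartanAlgebra (((γ : GL n R) : Matrix n n R)) :=
  mem_cartanAlgebra_iff.mpr (commute_inv_mul_twistGram σ H hH hg)

/-- `x = H⁻¹ H_g` is `⋆`-self-adjoint (`σ` an involution, `H` hermitian invertible): `x⋆ = (g⋆g)⋆ = g⋆ g⋆⋆ = g⋆ g = x`.
[cite: Rogawski1990, §3.5 p. 29] -/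
theorem hermStar_inv_mul_twistGram (hH : IsUnit H.det) (hσ : ∀ r : R, σ (σ r) = r) (hHh : (H.map σ)ᵀ = H) (g : Matrix n n R) :
    hermStar σ H (H⁻¹ * twistGram σ H g) = H⁻¹ * twistGram σ H g := by
  rw [inv_mul_twistGram_eq, hermStar_mul σ H hH, hermStar_hermStar σ H hH hσ hHh]

/-- **The criterion of R1 in `⋆`-language**: for a stable conjugator `g` (`g γ g⁻¹ = δ` in `GL_n(R)`) and `x := H⁻¹ H_g`,
`(∃ u ∈ U(H)(R), u γ u⁻¹ = δ) ↔ ∃ t ∈ GL_n(R), t γ = γ t ∧ t⋆ x t = 1` (for `H` invertible).  [cite: Rogawski1990, §3.1 p. 19] [cite: Kottwitz1986, §7] -/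
theorem exists_unitary_conj_iff_exists_hermStar_mul_mul_eq_one (hH : IsUnit H.det) {γ δ g : GL n R} (hg : g * γ * g⁻¹ = δ) :
    (∃ u : GL n R, u ∈ unitaryGroup σ H ∧ u * γ * u⁻¹ = δ) ↔
      ∃ t : GL n R, t * γ = γ * t ∧ hermStar σ H (t : Matrix n n R) * (H⁻¹ * twistGram σ H (g : Matrix n n R)) * (t : Matrix n n R) = 1 := by
  rw [exists_unitary_conj_iff_exists_commute_twistGram_eq σ H hg]
  refine exists_congr fun t => and_congr_right fun _ => ?_
  rw [Units.val_mul, ← inv_mul_twistGram_mul σ H hH]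
  constructor
  · intro h
    rw [h, Matrix.nonsing_inv_mul H hH]
  · intro h
    calc twistGram σ H ((g : Matrix n n R) * (t : Matrix n n R))
        = H * (H⁻¹ * twistGram σ H ((g : Matrix n n R) * (t : Matrix n n R))) := by
          rw [← Matrix.mul_assoc, Matrix.mul_nonsing_inv H hH, Matrix.one_mul]
      _ = H := by rw [h, Matrix.mul_one]

end Star

/-! ## §3 Over a field, for `γ` regular semisimple: `Z(γ)` is commutative and the criterion is a NORM condition -/

section Field

variable {K : Type*} [Field K] {n : Type*} [Fintype n] [DecidableEq n] (σ : K →+* K) (H : Matrix n n K)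

/-- **`Z(γ)` is commutative for `γ` with separable characteristic polynomial** (★ `commute_of_commute_of_charpoly_separable`).
[cite: Rogawski1990, §3.1 p. 19; §3.5 p. 29] -/
theorem mul_comm_of_mem_cartanAlgebra {γ : Matrix n n K} (hsep : γ.charpoly.Separable) {x y : Matrix n n K}
    (hx : x ∈ cartanAlgebra γ) (hy : y ∈ cartanAlgebra γ) : x * y = y * x :=
  (Literature.LinearAlgebra.Matrix.commute_of_commute_of_charpoly_separable hsep (mem_cartanAlgebra_iff.mp hx)
    (mem_cartanAlgebra_iff.mp hy)).eq

/-- **The criterion as a NORM condition** (field, `γ ∈ U(H)(K)` regular semisimple, `H` invertible): with `x := H⁻¹ H_g ∈ Z(γ)`,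
`(∃ u ∈ U(H)(K), u γ u⁻¹ = δ) ↔ ∃ t ∈ GL_n(K), t γ = γ t ∧ x · (t⋆ t) = 1` — `t⋆ x t = x t⋆ t` in the commutative `Z(γ)` — i.e. the class of `x` in
`(Z(γ)^{⋆})ˣ ∕ {t⋆ t : t ∈ Z(γ)ˣ} = Kˣ∕N_{KE∕K}((KE)ˣ) = H¹(F, T_γ)` is trivial. [cite: Rogawski1990, §3.5 Prop. 3.5.2 p. 29] [cite: Kottwitz1986, §7] -/
theorem exists_unitary_conj_iff_exists_norm_eq (hH : IsUnit H.det) {γ δ : unitaryGroup σ H}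
    (hsep : ((γ : GL n K) : Matrix n n K).charpoly.Separable) {g : GL n K} (hg : g * (γ : GL n K) * g⁻¹ = δ) :
    (∃ u : GL n K, u ∈ unitaryGroup σ H ∧ u * (γ : GL n K) * u⁻¹ = δ) ↔
      ∃ t : GL n K, t * (γ : GL n K) = γ * t ∧
        (H⁻¹ * twistGram σ H (g : Matrix n n K)) * (hermStar σ H (t : Matrix n n K) * (t : Matrix n n K)) = 1 := by
  rw [exists_unitary_conj_iff_exists_hermStar_mul_mul_eq_one σ H hH hg]
  refine exists_congr fun t => and_congr_right fun ht => ?_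
  -- `t⋆ x t = x t⋆ t` since `x, t⋆ ∈ Z(γ)` commute
  have hx : H⁻¹ * twistGram σ H (g : Matrix n n K) ∈ cartanAlgebra ((γ : GL n K) : Matrix n n K) :=
    inv_mul_twistGram_mem_cartanAlgebra σ H hH hg
  have htm : (t : Matrix n n K) ∈ cartanAlgebra ((γ : GL n K) : Matrix n n K) := by
    rw [mem_cartanAlgebra_iff]
    show (t : Matrix n n K) * ((γ : GL n K) : Matrix n n K) = ((γ : GL n K) : Matrix n n K) * (t : Matrix n n K)
    rw [← Units.val_mul, ht, Units.val_mul]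
  have hts : hermStar σ H (t : Matrix n n K) ∈ cartanAlgebra ((γ : GL n K) : Matrix n n K) :=
    hermStar_mem_cartanAlgebra σ H hH γ.2 htm
  rw [mul_comm_of_mem_cartanAlgebra hsep hts hx, Matrix.mul_assoc]

end Field

end Literature.NumberTheory.Rogawski1990

end
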